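import Summits.AnomalousDissipation.AnomalousDissipation.Theses.MomentParity
import Literature.Analysis.FluidPDE.BeltramiWavesCurl
import Summits.AnomalousDissipation.AnomalousDissipation.Theorems.MomentParityQuarticGateSignLemma
import Summits.AnomalousDissipation.AnomalousDissipation.Theorems.MomentParityQuarticGateDefectCertificate
import Summits.AnomalousDissipation.AnomalousDissipation.Theorems.MomentParityQuarticGateSurgery
import Summits.AnomalousDissipation.AnomalousDissipation.Theorems.MomentParityQuarticGatestub_order3Surgery
import Summits.AnomalousDissipation.AnomalousDissipation.Theorems.MomentParityQuarticGateOrder2Design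
import Summits.AnomalousDissipation.AnomalousDissipation.Theorems.QuarticGate.Negative.LevelOne
import Summits.AnomalousDissipation.AnomalousDissipation.Theorems.QuarticGate.Negative.LevelOneQuad

/-!
# `QuarticGate` from the Casimir classification (line `recession-cone`, the conditional composition)

Crux `Summit.AnomalousDissipation.AnomalousDissipation.Theses.MomentParity.QuarticGate`
(stmt-AnomalousDissipation-11464). The line `recession-cone` (Cruxes/QuarticGate/Lines/recession-cone.lean)
reduces the crux to six stubs; five are landed theorems of this directory —
`stub_order2Design` (S6, explicit loud order-2 Kolmogorov design), `stub_order3Surgery` (S5, order-3 surgery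
+ Slater upgrade modulo quadratic Casimirs), `stub_signLemma` (S1, Gaussian/Liouville sign lemma),
`stub_defectCertificate` (S3, recession-cone duality modulo cubic Casimirs), `stub_surgery` (S4, exact
far-atom surgery at order 4) — and the sixth, S2 = the Casimir classification of ball-truncated 3-D
Galerkin–Euler at frequently many levels (quadratic Casimirs are `αE + βH`; no homogeneous cubic Casimir),
is the conjectural content. This file lands the composition with S2 as an explicit HYPOTHESIS:
`quarticGate_of_casimirs : S2 → QuarticGate`, sorry-free. Whoever proves S2 (`stub_casimirs` of the
skeleton, verbatim the antecedent below) closes the crux by `quarticGate_of_casimirs h`.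

Proof (= `QuarticGate_of` of the skeleton): take `f, E, ε, ν₀` from S6 and `ν_j := ν₀/(j+2)`; at each `j`,
S6 gives `N₀`; the frequently-many clean levels of S2 meet `N ≥ N₀` (`Frequently.and_eventually`); at such
`N`, S6 gives the loud order-2 design `μ₀`, S5 (fed QuadRigidity) a Slater 3-stationary `μ₁` with the same
energy/dissipation, S3 (fed S1 and NoCubicCasimir) a defect certificate for `μ₁`, and S4 the 4-stationary
`μ` with energy `≤ E` and dissipation `≥ ε`.
-/

namespace Summit.AnomalousDissipation.AnomalousDissipation.Theorems.MomentParityQuarticGate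

open MeasureTheory Filter
open Literature.Analysis.FunctionSpaces Literature.Analysis.FluidPDE
open Summit.AnomalousDissipation.AnomalousDissipation.Theses.MomentParity
open Summit.AnomalousDissipation.AnomalousDissipation.Theorems.QuarticGate.Negative

set_option linter.dupNamespace false

/-- **`QuarticGate` from the Casimir classification.** If for frequently many levels `N` the
ball-truncated Galerkin–Euler system has (i) no nonzero homogeneous cubic polynomial invariant and
(ii) only the quadratic invariants `α|u|² + β(u, curl u)` (QuadRigidity, stated through the gradient
`2αP_N u + 2β curl P_N u`), then `MomentParity.QuarticGate` holds. The antecedent is verbatim the stub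
`stub_casimirs` (S2) of line `recession-cone`; everything else is proved (S1, S3–S6 landed). -/
theorem quarticGate_of_casimirs
    (hS2 : ∃ᶠ N in atTop,
    (∀ (m : ℕ) (g : Fin m → UnitAddTorus (Fin 3) → EuclideanSpace ℝ (Fin 3))
      (P : MvPolynomial (Fin m) ℝ),
      (∀ i, (Torus.IsSmooth (g i) ∧ Torus.IsDivFree (g i) ∧ Torus.HasZeroMean (g i) ∧
        ∀ k ∉ (Torus.freqBall N).erase (0 : Fin 3 → ℤ),
          UnitAddTorus.mFourierCoeff (EuclideanSpace.complexify ∘ (g i)) k = 0)) → P.IsHomogeneous 3 →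
      (∀ u : Torus.energySpace (Fin 3), (∀ k ∉ (Torus.freqBall N).erase (0 : Fin 3 → ℤ),
          UnitAddTorus.mFourierCoeff (EuclideanSpace.complexify ∘ (u.1 : UnitAddTorus (Fin 3) → EuclideanSpace ℝ (Fin 3))) k = 0) →
        Torus.nsGeneratorPairing (d := Fin 3) 0 0 u
          (fun x => ∑ i, (MvPolynomial.eval (fun j => Torus.pairing u.1 (g j))
            (MvPolynomial.pderiv i P)) • g i x) = 0) →
      ∀ u : Torus.energySpace (Fin 3), (∀ k ∉ (Torus.freqBall N).erase (0 : Fin 3 → ℤ),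
          UnitAddTorus.mFourierCoeff (EuclideanSpace.complexify ∘ (u.1 : UnitAddTorus (Fin 3) → EuclideanSpace ℝ (Fin 3))) k = 0) →
        MvPolynomial.eval (fun j => Torus.pairing u.1 (g j)) P = 0) ∧
    (∀ (m : ℕ) (g : Fin m → UnitAddTorus (Fin 3) → EuclideanSpace ℝ (Fin 3))
      (P : MvPolynomial (Fin m) ℝ),
      (∀ i, (Torus.IsSmooth (g i) ∧ Torus.IsDivFree (g i) ∧ Torus.HasZeroMean (g i) ∧
        ∀ k ∉ (Torus.freqBall N).erase (0 : Fin 3 → ℤ),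
          UnitAddTorus.mFourierCoeff (EuclideanSpace.complexify ∘ (g i)) k = 0)) → P.IsHomogeneous 2 →
      (∀ u : Torus.energySpace (Fin 3), (∀ k ∉ (Torus.freqBall N).erase (0 : Fin 3 → ℤ),
          UnitAddTorus.mFourierCoeff (EuclideanSpace.complexify ∘ (u.1 : UnitAddTorus (Fin 3) → EuclideanSpace ℝ (Fin 3))) k = 0) →
        Torus.nsGeneratorPairing (d := Fin 3) 0 0 u
          (fun x => ∑ i, (MvPolynomial.eval (fun j => Torus.pairing u.1 (g j))
            (MvPolynomial.pderiv i P)) • g i x) = 0) →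
      ∃ α β : ℝ, ∀ u : Torus.energySpace (Fin 3), (∀ k ∉ (Torus.freqBall N).erase (0 : Fin 3 → ℤ),
          UnitAddTorus.mFourierCoeff (EuclideanSpace.complexify ∘ (u.1 : UnitAddTorus (Fin 3) → EuclideanSpace ℝ (Fin 3))) k = 0) →
        ∀ x, (∑ i, (MvPolynomial.eval (fun j => Torus.pairing u.1 (g j))
            (MvPolynomial.pderiv i P)) • g i x) =
          (2 * α) • Torus.fourierTruncate N (u.1 : UnitAddTorus (Fin 3) → EuclideanSpace ℝ (Fin 3)) x +
          (2 * β) • BDSV.curl (Torus.fourierTruncate N (u.1 : UnitAddTorus (Fin 3) → EuclideanSpace ℝ (Fin 3))) x)) :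
    QuarticGate := by
  obtain ⟨f, hfs, hfd, hfz, E, ε, ν₀, hε, hν₀, hK1⟩ := stub_order2Design
  have hνpos : ∀ j : ℕ, 0 < ν₀ / ((j : ℝ) + 2) := fun j => div_pos hν₀ (by positivity)
  have hνlt : ∀ j : ℕ, ν₀ / ((j : ℝ) + 2) < ν₀ := fun j => by
    rw [div_lt_iff₀ (by positivity)]
    nlinarith [(Nat.cast_nonneg j : (0 : ℝ) ≤ j)]
  have hνlim : Tendsto (fun j : ℕ => ν₀ / ((j : ℝ) + 2)) atTop (nhds 0) :=
    tendsto_const_nhds.div_atTop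
      (tendsto_atTop_add_const_right atTop (2 : ℝ) tendsto_natCast_atTop_atTop)
  refine ⟨f, hfs, hfd, hfz, fun j => ν₀ / ((j : ℝ) + 2), E, ε, hνpos, hνlim, hε, fun j => ?_⟩
  obtain ⟨N₀, hN₀⟩ := hK1 _ (hνpos j) (hνlt j)
  refine (hS2.and_eventually (eventually_ge_atTop N₀)).mono ?_
  rintro N ⟨⟨hCub, hQuad⟩, hN⟩
  obtain ⟨μ₀, hp₀, hl₀, hR₀, hnd₀, hlin₀, hErow₀, hHrow₀, hE₀, hD₀⟩ := hN₀ N hN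
  obtain ⟨μ₁, hp₁, hl₁, hi₁, hsl₁, hst₁, hE₁, hD₁⟩ :=
    stub_order3Surgery _ f N μ₀ hfs hp₀ hl₀ hR₀ hnd₀ hlin₀ hErow₀ hHrow₀ hQuad
  obtain ⟨M, v, c, hcert⟩ :=
    stub_defectCertificate stub_signLemma N hCub _ f hfs μ₁ hp₁ hl₁ hi₁
  obtain ⟨μ, hp, hl, hi, hst, hE, hD⟩ :=
    stub_surgery _ f N μ₁ hfs hp₁ hl₁ hi₁ hsl₁ hst₁ M v c hcert
  refine ⟨μ, hp, hl, hi, hst, ?_, ?_⟩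
  · rw [hE, hE₁]; exact hE₀
  · rw [hD, hD₁]; exact hD₀

/-- **`QuarticGate` from the Casimir classification, vocabulary form** (registered sub-goal
`quarticGate_of_frequently_casimirs` of stmt-AnomalousDissipation-11464): with the named conjuncts
`NoCubicCasimir` (`Negative/LevelOne.lean`) and `QuadRigidity` (`Negative/LevelOneQuad.lean`), which
unfold definitionally to the antecedent of `quarticGate_of_casimirs`. Both conjuncts are FALSE at
`N = 1` (`not_noCubicCasimir_one`, `not_quadRigidity_one`) — harmless under `∃ᶠ N`. -/
theorem quarticGate_of_frequently_casimirs :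
    (∃ᶠ N in atTop, NoCubicCasimir N ∧ QuadRigidity N) → QuarticGate :=
  fun h => quarticGate_of_casimirs h

end Summit.AnomalousDissipation.AnomalousDissipation.Theorems.MomentParityQuarticGate
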